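import Literature.NumberTheory.Automorphic.LinearAlgebraicGroupsProofs
import Literature.NumberTheory.Automorphic.IdentityComponent
import Literature.NumberTheory.Automorphic.RootDataProofs
import Mathlib.Algebra.MonoidAlgebra.Basic
import Mathlib.LinearAlgebra.LinearIndependent.Lemmas
import Mathlib.LinearAlgebra.Eigenspace.Pi
import Mathlib.LinearAlgebra.Eigenspace.Semisimple
import Mathlib.LinearAlgebra.Eigenspace.Triangularizable
import Mathlib.LinearAlgebra.Matrix.Basis
import HarnessLib

/-!
# Characters and cocharacters of tori in `GL n`: Springer 3.2.11 (i) for `IsTorusSubgroup`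

Trunk T-AUTOMORPHIC (G25 AutomorphicL); proof file over
`Literature.NumberTheory.Automorphic.LinearAlgebraicGroups` (namespace `Literature.Automorphic`),
providing the torus input (Springer 3.2.11 (i)) of the assembly of
`Literature.NumberTheory.Automorphic.exists_isRootDatumOf` (Springer 7.4.3) in `ReductiveDualRootDatum.lean`, which uses
`exists_dualBases_of_isTorusSubgroup` directly. Springer, *Linear Algebraic Groups*
(2nd ed.), 3.2.11 (i): for a torus `T` the character group `X = X*(T)` and the cocharacter group
`Y = X_*(T)` are free abelian of finite rank (3.2.7 (iii)) and the pairing `⟨χ, λ⟩`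
(`χ (λ x) = x ^ ⟨χ, λ⟩`) is perfect. This file proves that statement for the tree's concrete
vocabulary (`IsTorusSubgroup T` for `T ≤ GL n k`, `characterLattice`, `cocharacterLattice`,
`charPairingInt`), over an algebraically closed field, in coordinate form:
there are `r` and isomorphisms `bX : X ≃ ℤʳ`, `bY : Y ≃ ℤʳ` (dual bases) with
`⟨χ, λ⟩ = ∑ᵢ (bX χ)ᵢ (bY λ)ᵢ` (`exists_dualBases_of_isTorusSubgroup`).

## Architecture (Springer §3.2, proof of 3.2.11 (i) by reduction to `T = 𝔻ₙ`)

* `exists_conj_le_diagonalSubgroup` (2.4.2 (ii) with 3.2.3): over an algebraically closed field a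
  commutative subgroup of `GL n k` consisting of semisimple elements is conjugate into the diagonal
  torus `𝔻ₙ` (Mathlib: a commuting family of triangularisable endomorphisms has a spanning,
  independent family of joint generalised eigenspaces; for semisimple endomorphisms these are
  eigenspaces, whence a common eigenbasis). `DiagonalizableGroups.lean` proves the same
  diagonalisation in weight-space form (`iSup_weightSpace_eq_top`) from the same Mathlib inputs.
* `eval_glCoordFun_diagonalGL` (3.2.2: `k[𝔻ₙ] = k[ℤⁿ]`): a polynomial in the coordinates of
  `GL n` restricts on `𝔻ₙ` to a Laurent polynomial in the diagonal entries (`laurentRestrict`).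
* `exists_diagChar_eq`, `weightHom_surjective` (3.2.3, (a) ⇒ (b), with Dedekind's theorem 3.2.1 =
  Mathlib `linearIndependent_monoidHom`): every algebraic character of a subgroup `T ≤ 𝔻ₙ` is a
  monomial character `t ↦ ∏ᵢ (t i i) ^ mᵢ`, i.e. the weight map `ℤⁿ → X*(T)` is surjective.
* `diagonalGL_mem_of_forall_diagChar` (3.2.10 (4), `(T^⊥)^⊥ = T`): a Zariski-closed `T ≤ 𝔻ₙ`
  is cut out by the monomial characters that are trivial on it.
* `mem_range_coweightHom_iff`, `charPairingInt_diagChar` (3.2.2 and 3.2.11 (i) for `𝔻ₙ`): the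
  algebraic cocharacters of `T ≤ 𝔻ₙ` are `x ↦ diag(x ^ a₁, …, x ^ aₙ)` for the `a ∈ ℤⁿ`
  orthogonal to the kernel of the weight map, and `⟨χₘ, λₐ⟩ = ∑ᵢ mᵢ aᵢ`.
* `exists_dualBases_of_surjective_of_injective` (the `ℤ`-linear algebra of 3.2.11 (i)): a
  torsion-free quotient `A` of `ℤⁿ` and the orthogonal `B ≤ ℤⁿ` of the kernel are in perfect
  duality under the standard pairing (Mathlib: finitely generated torsion-free `ℤ`-modules are
  free; dual basis).
* `exists_dualBases_of_le_diagonalSubgroup` (the diagonal case) and transport along `Int(g)`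
  (`IsAlgebraicSubgroup.map_conj` of `IdentityComponent.lean`, `characterLatticeConjEquiv`,
  `cocharacterLatticeConjEquiv`, `charPairingInt_comp_conjEquiv`) give
  `exists_dualBases_of_isTorusSubgroup`.

Inputs from the tree: torsion-freeness of `X*(T)` for Zariski-connected `T`
(`isMulTorsionFree_characterLattice`, `RootDataProofs.lean`; Springer 3.2.7 (iii)) and the
characters of `𝔾ₘ` over an infinite field (`charPairingInt_spec_holds`,
`exists_unique_charPairing_holds`, `zpowGroupHom_units_injective`,
`LinearAlgebraicGroupsProofs.lean`).

## References

* [SpringerLAG1998] T. A. Springer, *Linear Algebraic Groups*, 2nd ed., Progress in Mathematics 9,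
  Birkhäuser, 1998: 2.4.2, 3.2.1–3.2.3, 3.2.7, 3.2.10, 3.2.11.
-/

open scoped IsMulCommutative

noncomputable section

namespace Literature.NumberTheory.Automorphic

variable {k : Type*} [Field k] {n : Type*} [Fintype n] [DecidableEq n]

/-! ### Coordinates on the diagonal torus -/

/-- `diagonalGL` is injective. [folklore] -/
theorem diagonalGL_injective : Function.Injective (diagonalGL n k) := by
  intro d d' h
  funext i
  have := congrArg (fun g : GL n k => (g : Matrix n n k) i i) h
  simp only [coe_diagonalGL, Matrix.diagonal_apply_eq] at this
  exact Units.ext this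

/-- `(kˣ)ⁿ ≃* 𝔻ₙ`. [folklore] -/
def diagonalSubgroupEquiv (n k : Type*) [Field k] [Fintype n] [DecidableEq n] :
    (n → kˣ) ≃* ↥(diagonalSubgroup n k) :=
  MonoidHom.ofInjective diagonalGL_injective

/-- `diagonalSubgroupEquiv d` is the diagonal matrix `diag(d)`. [folklore] -/
@[simp] lemma coe_diagonalSubgroupEquiv (d : n → kˣ) :
    ((diagonalSubgroupEquiv n k d : ↥(diagonalSubgroup n k)) : GL n k) = diagonalGL n k d := rfl

/-- `diag` of the coordinates of `t ∈ 𝔻ₙ` is `t`. [folklore] -/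
lemma diagonalGL_symm_diagonalSubgroupEquiv (t : ↥(diagonalSubgroup n k)) :
    diagonalGL n k ((diagonalSubgroupEquiv n k).symm t) = (t : GL n k) := by
  conv_rhs => rw [← (diagonalSubgroupEquiv n k).apply_symm_apply t]
  rfl

variable {T : Subgroup (GL n k)}

/-- The diagonal entries of an element of `T ≤ 𝔻ₙ`, as a homomorphism `T → (kˣ)ⁿ`. [folklore] -/
def diagCoord (hT : T ≤ diagonalSubgroup n k) : ↥T →* (n → kˣ) :=
  (diagonalSubgroupEquiv n k).symm.toMonoidHom.comp (Subgroup.inclusion hT)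

/-- `diag (diagCoord t) = t` for `t ∈ T ≤ 𝔻ₙ`. [folklore] -/
lemma diagonalGL_diagCoord (hT : T ≤ diagonalSubgroup n k) (t : ↥T) :
    diagonalGL n k (diagCoord hT t) = (t : GL n k) :=
  diagonalGL_symm_diagonalSubgroupEquiv ⟨(t : GL n k), hT t.2⟩

/-- The matrix entries of `t ∈ T ≤ 𝔻ₙ` in terms of `diagCoord`. [folklore] -/
lemma coe_apply_diagCoord (hT : T ≤ diagonalSubgroup n k) (t : ↥T) (i j : n) :
    ((t : GL n k) : Matrix n n k) i j = if i = j then (diagCoord hT t i : k) else 0 := by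
  rw [← diagonalGL_diagCoord hT t, coe_diagonalGL, Matrix.diagonal_apply]

/-- `diagCoord` is injective. [folklore] -/
lemma diagCoord_injective (hT : T ≤ diagonalSubgroup n k) : Function.Injective (diagCoord hT) := by
  intro t t' h
  apply Subtype.ext
  rw [← diagonalGL_diagCoord hT t, ← diagonalGL_diagCoord hT t', h]

/-- The `i`-th diagonal entry character `t ↦ t i i` of `T ≤ 𝔻ₙ`. [cite: SpringerLAG1998, 3.2.2] -/
def diagEntryChar (hT : T ≤ diagonalSubgroup n k) (i : n) : ↥T →* kˣ :=
  (Pi.evalMonoidHom (fun _ : n => kˣ) i).comp (diagCoord hT)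

/-- Unfolding of `diagEntryChar`. [folklore] -/
lemma diagEntryChar_apply (hT : T ≤ diagonalSubgroup n k) (i : n) (t : ↥T) :
    diagEntryChar hT i t = diagCoord hT t i := rfl

/-- The diagonal entry characters are algebraic (given by a coordinate polynomial).
[cite: SpringerLAG1998, 3.2.2] -/
lemma isAlgebraicChar_diagEntryChar (hT : T ≤ diagonalSubgroup n k) (i : n) :
    IsAlgebraicChar (diagEntryChar hT i) :=
  ⟨MvPolynomial.X (Sum.inl (i, i)), fun t => by
    rw [MvPolynomial.eval_X, glCoordFun_inl, coe_apply_diagCoord hT, if_pos rfl,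
      diagEntryChar_apply]⟩

/-- The monomial character `t ↦ ∏ᵢ (t i i) ^ (m i)` of `T ≤ 𝔻ₙ`. [cite: SpringerLAG1998, 3.2.2] -/
def diagChar (hT : T ≤ diagonalSubgroup n k) (m : n → ℤ) : ↥T →* kˣ :=
  ∏ i, diagEntryChar hT i ^ m i

/-- Unfolding of `diagChar`: `χₘ(t) = ∏ᵢ (t i i) ^ (m i)`. [folklore] -/
lemma diagChar_apply (hT : T ≤ diagonalSubgroup n k) (m : n → ℤ) (t : ↥T) :
    diagChar hT m t = ∏ i, diagCoord hT t i ^ m i := by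
  simp [diagChar, MonoidHom.finsetProd_apply, MonoidHom.zpow_apply, diagEntryChar_apply]

/-- Monomial characters are algebraic, i.e. lie in `X*(T)`. [cite: SpringerLAG1998, 3.2.2] -/
lemma diagChar_mem_characterLattice (hT : T ≤ diagonalSubgroup n k) (m : n → ℤ) :
    diagChar hT m ∈ characterLattice T :=
  Subgroup.prod_mem _ fun i _ =>
    Subgroup.zpow_mem _ (isAlgebraicChar_diagEntryChar hT i) _

/-- `χ₀ = 1`. [folklore] -/
lemma diagChar_zero (hT : T ≤ diagonalSubgroup n k) : diagChar hT 0 = 1 := by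
  ext t : 1
  simp [diagChar_apply]

/-- `χ_(m + m') = χₘ χ_(m')`: `m ↦ χₘ` is a homomorphism `ℤⁿ → X*(T)` (Springer 3.2.2).
[cite: SpringerLAG1998, 3.2.2] -/
lemma diagChar_add (hT : T ≤ diagonalSubgroup n k) (m m' : n → ℤ) :
    diagChar hT (m + m') = diagChar hT m * diagChar hT m' := by
  ext t : 1
  simp [diagChar_apply, zpow_add, Finset.prod_mul_distrib]

/-- The weight homomorphism `ℤⁿ → X*(T)`, `m ↦ (t ↦ ∏ᵢ (t i i) ^ (m i))`.
[cite: SpringerLAG1998, 3.2.2] -/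
def weightHom (hT : T ≤ diagonalSubgroup n k) : (n → ℤ) →+ Additive ↥(characterLattice T) where
  toFun m := Additive.ofMul ⟨diagChar hT m, diagChar_mem_characterLattice hT m⟩
  map_zero' := by
    apply Additive.toMul.injective
    apply Subtype.ext
    simpa using diagChar_zero hT
  map_add' m m' := by
    apply Additive.toMul.injective
    apply Subtype.ext
    simpa using diagChar_add hT m m'

/-- Unfolding of `weightHom`. [folklore] -/
lemma coe_weightHom (hT : T ≤ diagonalSubgroup n k) (m : n → ℤ) :
    ((Additive.toMul (weightHom hT m) : ↥(characterLattice T)) : ↥T →* kˣ) = diagChar hT m := rfl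

/-! ### Restriction of polynomial functions to the diagonal torus: Laurent polynomials -/

/-- The restriction map `k[x i j, det⁻¹] → k[ℤⁿ]` (Laurent polynomials in the diagonal entries).
[cite: SpringerLAG1998, 3.2.2] -/
def laurentRestrict (n k : Type*) [Field k] [Fintype n] [DecidableEq n] :
    MvPolynomial (GLCoord n) k →ₐ[k] AddMonoidAlgebra k (n → ℤ) :=
  MvPolynomial.aeval fun c => match c with
    | Sum.inl ij => if ij.1 = ij.2 then AddMonoidAlgebra.single (Pi.single ij.1 1) 1 else 0
    | Sum.inr _ => AddMonoidAlgebra.single (fun _ => -1) 1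

omit [DecidableEq n] in
/-- Evaluation of a Laurent polynomial at `d ∈ (kˣ)ⁿ`: the monomial `m` goes to `∏ᵢ d i ^ m i`.
[folklore] -/
def monomialEval (d : n → kˣ) : Multiplicative (n → ℤ) →* k where
  toFun m := ((∏ i, d i ^ (m.toAdd i) : kˣ) : k)
  map_one' := by simp
  map_mul' m m' := by
    rw [← Units.val_mul, ← Finset.prod_mul_distrib]
    simp [zpow_add]

omit [DecidableEq n] in
/-- Evaluation `k[ℤⁿ] → k` at `d`. [folklore] -/
def laurentEval (d : n → kˣ) : AddMonoidAlgebra k (n → ℤ) →ₐ[k] k :=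
  AddMonoidAlgebra.lift k k (n → ℤ) (monomialEval d)

omit [DecidableEq n] in
/-- `laurentEval d` on a monomial `a t^m` is `a ∏ᵢ d i ^ m i`. [folklore] -/
lemma laurentEval_single (d : n → kˣ) (m : n → ℤ) (a : k) :
    laurentEval d (AddMonoidAlgebra.single m a) = a * ((∏ i, d i ^ m i : kˣ) : k) := by
  simp [laurentEval, monomialEval, AddMonoidAlgebra.lift_single]

omit [DecidableEq n] in
/-- `laurentEval d L = ∑ₘ L(m) ∏ᵢ d i ^ m i`. [folklore] -/
lemma laurentEval_apply (d : n → kˣ) (L : AddMonoidAlgebra k (n → ℤ)) :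
    laurentEval d L = L.coeff.sum fun m a => a * ((∏ i, d i ^ m i : kˣ) : k) := by
  simp [laurentEval, monomialEval, AddMonoidAlgebra.lift_apply]

/-- `∏ₗ d l ^ (δᵢ l) = d i`. [folklore] -/
lemma prod_zpow_single (d : n → kˣ) (i : n) : ∏ l, d l ^ (Pi.single i (1 : ℤ) : n → ℤ) l = d i := by
  rw [Finset.prod_eq_single i]
  · simp
  · intro l _ hl
    simp [hl]
  · simp

/-- A polynomial in the coordinates of `GL n`, evaluated at a diagonal matrix, is its Laurent
restriction evaluated at the diagonal entries. [cite: SpringerLAG1998, 3.2.2] -/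
theorem eval_glCoordFun_diagonalGL (p : MvPolynomial (GLCoord n) k) (d : n → kˣ) :
    MvPolynomial.eval (glCoordFun (diagonalGL n k d)) p =
      laurentEval d (laurentRestrict n k p) := by
  change MvPolynomial.aeval (glCoordFun (diagonalGL n k d)) p =
    ((laurentEval d).comp (laurentRestrict n k)) p
  congr 1
  refine MvPolynomial.algHom_ext fun c => ?_
  rw [MvPolynomial.aeval_X, AlgHom.comp_apply, laurentRestrict, MvPolynomial.aeval_X]
  rcases c with ⟨i, j⟩ | u
  · simp only [glCoordFun_inl, coe_diagonalGL, Matrix.diagonal_apply]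
    split_ifs with h
    · subst h
      rw [laurentEval_single, one_mul, prod_zpow_single]
    · rw [map_zero]
  · simp only [glCoordFun_inr, coe_diagonalGL, Matrix.det_diagonal]
    rw [laurentEval_single, one_mul]
    simp [Finset.prod_inv_distrib]

section Dedekind

variable {G : Type*} [Group G] {K : Type*} [Field K] {ι : Type*}

open Classical in
/-- If a finite linear combination of characters `G → K` (possibly with repetitions) vanishes,
then for every character the sum of the coefficients of its occurrences vanishes (Dedekind's
theorem: distinct characters are linearly independent; Springer 3.2.1).
[cite: SpringerLAG1998, 3.2.1] -/
theorem sum_filter_eq_zero_of_sum_smul_monoidHom_eq_zero (s : Finset ι) (c : ι → K)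
    (ψ : ι → G →* K) (h : ∑ i ∈ s, c i • (⇑(ψ i) : G → K) = 0) (f : G →* K) :
    ∑ i ∈ s with ψ i = f, c i = 0 := by
  by_cases hf : f ∈ s.image ψ
  · have hsum : ∑ g ∈ s.image ψ, (∑ i ∈ s with ψ i = g, c i) • (⇑g : G → K) = 0 := by
      rw [← h, Finset.sum_image' (fun i => c i • (⇑(ψ i) : G → K))]
      intro i hi
      rw [Finset.sum_smul]
      refine Finset.sum_congr rfl fun j hj => ?_
      rw [(Finset.mem_filter.mp hj).2]
    exact linearIndependent_iff'.mp (linearIndependent_monoidHom G K) (s.image ψ) _ hsum f hf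
  · refine Finset.sum_eq_zero fun i hi => ?_
    exact absurd (Finset.mem_image_of_mem ψ (Finset.mem_filter.mp hi).1)
      ((Finset.mem_filter.mp hi).2 ▸ hf)

/-- If a character `χ : G → K` is a finite linear combination of characters `ψ i`, then it is one
of them (Dedekind's theorem; Springer 3.2.1, 3.2.3). [cite: SpringerLAG1998, 3.2.1] -/
theorem exists_eq_of_sum_smul_monoidHom_eq (s : Finset ι) (c : ι → K)
    (ψ : ι → G →* K) (χ : G →* K) (h : ∑ i ∈ s, c i • (⇑(ψ i) : G → K) = χ) :
    ∃ i ∈ s, ψ i = χ := by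
  classical
  by_contra hne
  push Not at hne
  have hχ : χ ∉ s.image ψ := fun hmem => by
    obtain ⟨i, hi, rfl⟩ := Finset.mem_image.mp hmem
    exact hne i hi rfl
  -- coefficients on `insert χ (s.image ψ)`
  let g : (G →* K) → K := fun f => if f = χ then -1 else ∑ i ∈ s with ψ i = f, c i
  have hsum : ∑ f ∈ insert χ (s.image ψ), g f • (⇑f : G → K) = 0 := by
    rw [Finset.sum_insert hχ]
    have h1 : ∑ f ∈ s.image ψ, g f • (⇑f : G → K) = ∑ i ∈ s, c i • (⇑(ψ i) : G → K) := by
      rw [Finset.sum_image' (fun i => c i • (⇑(ψ i) : G → K))]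
      intro i hi
      have hne' : ψ i ≠ χ := hne i hi
      simp only [g, if_neg hne']
      rw [Finset.sum_smul]
      refine Finset.sum_congr rfl fun j hj => ?_
      rw [(Finset.mem_filter.mp hj).2]
    rw [h1, h]
    simp [g]
  have := linearIndependent_iff'.mp (linearIndependent_monoidHom G K) _ g hsum χ
    (Finset.mem_insert_self χ _)
  simp [g] at this

end Dedekind

/-- The standard pairing via `toDual` on `N → ℤ`. [folklore] -/
theorem basisFun_toDual_apply {N : Type*} [Fintype N] [DecidableEq N] (x y : N → ℤ) :
    (Pi.basisFun ℤ N).toDual x y = ∑ i, x i * y i := by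
  conv_lhs => rw [← (Pi.basisFun ℤ N).sum_repr y]
  rw [map_sum]
  refine Finset.sum_congr rfl fun i _ => ?_
  rw [LinearMap.map_smul, Module.Basis.toDual_apply_left, Pi.basisFun_repr, Pi.basisFun_repr,
    smul_eq_mul, mul_comm]

/-- Lattice duality in coordinates (Springer 3.2.11 (i), linear-algebra part).
[cite: SpringerLAG1998, 3.2.11 (i)] -/
theorem exists_dualBases_of_surjective_of_injective {N A B : Type*} [Fintype N] [DecidableEq N]
    [AddCommGroup A] [IsAddTorsionFree A] [AddCommGroup B]
    (wt : (N → ℤ) →ₗ[ℤ] A) (hwt : Function.Surjective wt)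
    (cw : B →ₗ[ℤ] (N → ℤ)) (hcw : Function.Injective cw)
    (hrange : ∀ a : N → ℤ,
      a ∈ LinearMap.range cw ↔ ∀ m ∈ LinearMap.ker wt, ∑ i, m i * a i = 0) :
    ∃ (r : ℕ) (bX : A ≃ₗ[ℤ] (Fin r → ℤ)) (bY : B ≃ₗ[ℤ] (Fin r → ℤ)),
      ∀ (m : N → ℤ) (b : B), ∑ i, m i * cw b i = ∑ i, bX (wt m) i * bY b i := by
  haveI : Module.Finite ℤ A := Module.Finite.of_surjective wt hwt
  haveI : Module.Free ℤ A := Module.free_of_finite_type_torsion_free'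
  let bA := Module.finBasis ℤ A
  -- a linear section of `wt`
  obtain ⟨s, hs⟩ := Module.projective_lifting_property wt (LinearMap.id : A →ₗ[ℤ] A) hwt
  let τ : (N → ℤ) →ₗ[ℤ] Module.Dual ℤ (N → ℤ) := (Pi.basisFun ℤ N).toDual
  have hτ : ∀ x y : N → ℤ, τ x y = ∑ i, x i * y i := basisFun_toDual_apply
  -- the functional of `cw b` kills `ker wt`
  have hkill : ∀ (b : B), ∀ m ∈ LinearMap.ker wt, τ (cw b) m = 0 := fun b m hm => by
    rw [hτ]
    have := (hrange (cw b)).mp (LinearMap.mem_range_self cw b) m hm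
    simpa [mul_comm] using this
  let ψ : B →ₗ[ℤ] Module.Dual ℤ A := (LinearMap.lcomp ℤ ℤ s).comp (τ.comp cw)
  have hψ : ∀ (b : B) (m : N → ℤ), ψ b (wt m) = τ (cw b) m := fun b m => by
    simp only [ψ, LinearMap.comp_apply, LinearMap.lcomp_apply]
    have hdiff : s (wt m) - m ∈ LinearMap.ker wt := by
      rw [LinearMap.mem_ker, map_sub, sub_eq_zero]
      exact LinearMap.congr_fun hs (wt m)
    have := hkill b _ hdiff
    rwa [map_sub, sub_eq_zero] at this
  have hψinj : Function.Injective ψ := by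
    intro b₁ b₂ h
    apply hcw
    apply (Pi.basisFun ℤ N).toDual_injective
    refine LinearMap.ext fun m => ?_
    change τ (cw b₁) m = τ (cw b₂) m
    rw [← hψ, ← hψ, h]
  have hψsurj : Function.Surjective ψ := by
    intro f
    let a : N → ℤ := (Pi.basisFun ℤ N).toDualEquiv.symm (f.comp wt)
    have ha : τ a = f.comp wt := by
      simp only [a, τ, ← Module.Basis.toDualEquiv_apply, LinearEquiv.apply_symm_apply]
    have hamem : a ∈ LinearMap.range cw := by
      rw [hrange]
      intro m hm
      have := LinearMap.congr_fun ha m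
      rw [hτ] at this
      rw [LinearMap.mem_ker] at hm
      simp only [LinearMap.comp_apply, hm, map_zero] at this
      simpa [mul_comm] using this
    obtain ⟨b, hb⟩ := hamem
    refine ⟨b, LinearMap.ext fun x => ?_⟩
    obtain ⟨m, rfl⟩ := hwt x
    rw [hψ, hb, ha, LinearMap.comp_apply]
  let ψe : B ≃ₗ[ℤ] Module.Dual ℤ A := LinearEquiv.ofBijective ψ ⟨hψinj, hψsurj⟩
  refine ⟨Module.finrank ℤ A, bA.equivFun, ψe.trans bA.dualBasis.equivFun, fun m b => ?_⟩
  have hsum : ∑ i, bA.equivFun (wt m) i * (ψe.trans bA.dualBasis.equivFun) b i = ψ b (wt m) := by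
    simp only [LinearEquiv.trans_apply, Module.Basis.equivFun_apply, Module.Basis.dualBasis_repr,
      ψe, LinearEquiv.ofBijective_apply]
    conv_rhs => rw [← bA.sum_repr (wt m)]
    rw [map_sum]
    refine Finset.sum_congr rfl fun i _ => ?_
    rw [LinearMap.map_smul, smul_eq_mul]
  rw [hsum, hψ, hτ]
  simp [mul_comm]

/-! ### Characters of a subgroup of the diagonal torus -/

section DiagonalCharacters

variable {T : Subgroup (GL n k)}

/-- On `T ≤ 𝔻ₙ`, an algebraic character given by the polynomial `p` is the linear combination
`∑ₘ L(m) χₘ` of monomial characters, `L` the Laurent restriction of `p`.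
[cite: SpringerLAG1998, 3.2.3] -/
lemma coe_apply_eq_sum_of_isAlgebraicChar (hT : T ≤ diagonalSubgroup n k) {χ : ↥T →* kˣ}
    {p : MvPolynomial (GLCoord n) k}
    (hp : ∀ t : ↥T, ((χ t : kˣ) : k) = MvPolynomial.eval (glCoordFun (t : GL n k)) p) (t : ↥T) :
    ((χ t : kˣ) : k) = (laurentRestrict n k p).coeff.sum
      fun m a => a * ((diagChar hT m t : kˣ) : k) := by
  rw [hp t, ← diagonalGL_diagCoord hT t, eval_glCoordFun_diagonalGL, laurentEval_apply]
  simp only [diagChar_apply]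

/-- **Every algebraic character of a subgroup `T` of the diagonal torus is a monomial**
`t ↦ ∏ᵢ (t i i) ^ (m i)` (Springer 3.2.3, proof of (a) ⇒ (b): the restrictions of the characters
of `𝔻ₙ` span `k[T]`, and by Dedekind's theorem a character is one of them).
[cite: SpringerLAG1998, 3.2.3] -/
theorem exists_diagChar_eq (hT : T ≤ diagonalSubgroup n k) {χ : ↥T →* kˣ}
    (hχ : IsAlgebraicChar χ) : ∃ m : n → ℤ, diagChar hT m = χ := by
  classical
  obtain ⟨p, hp⟩ := hχ
  set L := laurentRestrict n k p with hL
  have hfun : ∑ m ∈ L.coeff.support, L.coeff m • (⇑((Units.coeHom k).comp (diagChar hT m)) :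
      ↥T → k) = ⇑((Units.coeHom k).comp χ) := by
    funext t
    rw [Finset.sum_apply]
    simp only [Pi.smul_apply, MonoidHom.coe_comp, Function.comp_apply, Units.coeHom_apply,
      smul_eq_mul]
    rw [coe_apply_eq_sum_of_isAlgebraicChar hT hp t, Finsupp.sum]
  obtain ⟨m, -, hm⟩ := exists_eq_of_sum_smul_monoidHom_eq _ _ _ _ hfun
  refine ⟨m, MonoidHom.ext fun t => Units.ext ?_⟩
  simpa using DFunLike.congr_fun hm t

/-- The weight homomorphism `ℤⁿ → X*(T)` is surjective for `T ≤ 𝔻ₙ` (Springer 3.2.3: the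
restriction `X*(𝔻ₙ) → X*(T)` is surjective). [cite: SpringerLAG1998, 3.2.3] -/
theorem weightHom_surjective (hT : T ≤ diagonalSubgroup n k) :
    Function.Surjective (weightHom hT) := by
  intro x
  obtain ⟨m, hm⟩ := exists_diagChar_eq hT (Additive.toMul x).2
  refine ⟨m, Additive.toMul.injective (Subtype.ext ?_)⟩
  simpa [coe_weightHom] using hm

/-- **A closed subgroup of the diagonal torus is defined by characters** (Springer 3.2.10 (4),
`(H^⊥)^⊥ = H`): if `T ≤ 𝔻ₙ` is Zariski closed in `GL n` and `d ∈ (kˣ)ⁿ` satisfies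
`∏ᵢ d i ^ m i = 1` for every `m` whose monomial character is trivial on `T`, then
`diag(d) ∈ T`. Proof: a defining polynomial restricts to a Laurent polynomial `∑ L(m) t^m`
vanishing on `T`; by Dedekind the coefficients of each character `t^m|_T` sum to zero, and on `d`
the monomials of one class take one value. [cite: SpringerLAG1998, 3.2.10 (4)] -/
theorem diagonalGL_mem_of_forall_diagChar (hTalg : IsAlgebraicSubgroup T)
    (hT : T ≤ diagonalSubgroup n k) (d : n → kˣ)
    (hd : ∀ m : n → ℤ, diagChar hT m = 1 → ∏ i, d i ^ m i = 1) : diagonalGL n k d ∈ T := by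
  classical
  obtain ⟨S, hS⟩ := hTalg
  rw [← SetLike.mem_coe, hS]
  intro p hpS
  set L := laurentRestrict n k p with hL
  -- `p` vanishes on `T`
  have hvan : ∀ t : ↥T, MvPolynomial.eval (glCoordFun (t : GL n k)) p = 0 := fun t => by
    have ht : (t : GL n k) ∈ zeroLocusGL S := hS ▸ t.2
    exact ht p hpS
  let ψ : (n → ℤ) → ↥T →* k := fun m => (Units.coeHom k).comp (diagChar hT m)
  have hfun : ∑ m ∈ L.coeff.support, L.coeff m • (⇑(ψ m) : ↥T → k) = 0 := by
    funext t
    rw [Finset.sum_apply, Pi.zero_apply]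
    simp only [ψ, Pi.smul_apply, MonoidHom.coe_comp, Function.comp_apply, Units.coeHom_apply,
      smul_eq_mul]
    have := hvan t
    rw [← diagonalGL_diagCoord hT t, eval_glCoordFun_diagonalGL, laurentEval_apply,
      Finsupp.sum] at this
    simpa only [diagChar_apply] using this
  have hfiber := sum_filter_eq_zero_of_sum_smul_monoidHom_eq_zero _ _ _ hfun
  -- monomials with the same character on `T` take the same value at `d`
  have hclass : ∀ m m' : n → ℤ, ψ m = ψ m' → ∏ i, d i ^ m i = ∏ i, d i ^ m' i := by
    intro m m' hmm'
    have h1 : diagChar hT (m - m') = 1 := by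
      refine MonoidHom.ext fun t => ?_
      have ht : diagChar hT m t = diagChar hT m' t := Units.ext (DFunLike.congr_fun hmm' t)
      rw [MonoidHom.one_apply, diagChar_apply]
      simp only [Pi.sub_apply, zpow_sub, Finset.prod_mul_distrib,
        Finset.prod_inv_distrib]
      rw [← diagChar_apply, ← diagChar_apply, ht, mul_inv_cancel]
    have h2 := hd _ h1
    simp only [Pi.sub_apply, zpow_sub, Finset.prod_mul_distrib,
      Finset.prod_inv_distrib] at h2
    rwa [mul_inv_eq_one] at h2
  rw [eval_glCoordFun_diagonalGL, laurentEval_apply, Finsupp.sum,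
    ← Finset.sum_fiberwise_of_maps_to (t := L.coeff.support.image ψ) (g := ψ)
      fun j hj => Finset.mem_image_of_mem ψ hj]
  refine Finset.sum_eq_zero fun f hf => ?_
  obtain ⟨m₀, hm₀, rfl⟩ := Finset.mem_image.mp hf
  have : ∀ j ∈ L.coeff.support.filter (fun j => ψ j = ψ m₀),
      L.coeff j * ((∏ i, d i ^ j i : kˣ) : k) = L.coeff j * ((∏ i, d i ^ m₀ i : kˣ) : k) := by
    intro j hj
    rw [hclass j m₀ (Finset.mem_filter.mp hj).2]
  rw [Finset.sum_congr rfl this, ← Finset.sum_mul, hfiber (ψ m₀), zero_mul]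

end DiagonalCharacters

/-! ### Cocharacters of a subgroup of the diagonal torus -/

section DiagonalCocharacters

variable {T : Subgroup (GL n k)} [IsMulCommutative ↥T]

/-- The exponent vector `a ∈ ℤⁿ` of an algebraic cocharacter `λ` of `T ≤ 𝔻ₙ`:
`a i = ⟨(t ↦ t i i), λ⟩`, so that `λ(x) = diag(x ^ a 1, …, x ^ a n)` (Springer 3.2.2).
[cite: SpringerLAG1998, 3.2.2] -/
def coweightOf (hT : T ≤ diagonalSubgroup n k) (γ : ↥(cocharacterLattice T)) : n → ℤ :=
  fun i => charPairingInt (diagEntryChar hT i) (γ : kˣ →* ↥T)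

/-- `λ(x) i i = x ^ a i` for the exponent vector `a` of the cocharacter `λ` (Springer 3.2.2 with
`charPairingInt_spec`). [cite: SpringerLAG1998, 3.2.2] -/
lemma diagCoord_apply_eq_zpow_coweightOf [Infinite k] (hT : T ≤ diagonalSubgroup n k)
    (γ : ↥(cocharacterLattice T)) (x : kˣ) (i : n) :
    diagCoord hT ((γ : kˣ →* ↥T) x) i = x ^ coweightOf hT γ i :=
  charPairingInt_spec_holds (isAlgebraicChar_diagEntryChar hT i) γ.2 x

/-- `λ(x) = diag(x ^ a 1, …, x ^ a n)` for the exponent vector `a` of `λ` (Springer 3.2.2).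
[cite: SpringerLAG1998, 3.2.2] -/
lemma diagCoord_apply_eq [Infinite k] (hT : T ≤ diagonalSubgroup n k)
    (γ : ↥(cocharacterLattice T)) (x : kˣ) :
    diagCoord hT ((γ : kˣ →* ↥T) x) = fun i => x ^ coweightOf hT γ i :=
  funext (diagCoord_apply_eq_zpow_coweightOf hT γ x)

omit [Fintype n] [DecidableEq n] in
/-- `x ↦ (x ^ a i)ᵢ` determines `a` (characters of `𝔾ₘ` are distinct over an infinite field).
[folklore] -/
lemma zpow_vec_injective [Infinite k] : Function.Injective
    fun a : n → ℤ => fun x : kˣ => fun i => x ^ a i := by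
  intro a b h
  funext i
  apply zpowGroupHom_units_injective (k := k)
  ext x : 1
  simpa using congrFun (congrFun h x) i

/-- The coweight homomorphism `X_*(T) → ℤⁿ` for `T ≤ 𝔻ₙ`. [cite: SpringerLAG1998, 3.2.2] -/
def coweightHom [Infinite k] (hT : T ≤ diagonalSubgroup n k) :
    Additive ↥(cocharacterLattice T) →+ (n → ℤ) where
  toFun γ := coweightOf hT (Additive.toMul γ)
  map_zero' := by
    apply zpow_vec_injective (k := k)
    funext x i
    simp only [Pi.zero_apply, zpow_zero]
    rw [← diagCoord_apply_eq_zpow_coweightOf]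
    simp
  map_add' γ γ' := by
    apply zpow_vec_injective (k := k)
    funext x i
    simp only [Pi.add_apply, zpow_add]
    rw [← diagCoord_apply_eq_zpow_coweightOf, ← diagCoord_apply_eq_zpow_coweightOf,
      ← diagCoord_apply_eq_zpow_coweightOf, toMul_add, Subgroup.coe_mul, MonoidHom.mul_apply,
      map_mul, Pi.mul_apply]

/-- Unfolding of `coweightHom`. [folklore] -/
lemma coweightHom_apply [Infinite k] (hT : T ≤ diagonalSubgroup n k)
    (γ : ↥(cocharacterLattice T)) : coweightHom hT (Additive.ofMul γ) = coweightOf hT γ := rfl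

/-- A cocharacter of `T ≤ 𝔻ₙ` is determined by its exponent vector. [cite: SpringerLAG1998, 3.2.2]
-/
lemma coweightHom_injective [Infinite k] (hT : T ≤ diagonalSubgroup n k) :
    Function.Injective (coweightHom hT) := by
  intro γ γ' h
  apply Additive.toMul.injective
  apply Subtype.ext
  refine MonoidHom.ext fun x => diagCoord_injective hT ?_
  rw [diagCoord_apply_eq, diagCoord_apply_eq]
  exact congrArg (fun a : n → ℤ => fun i => x ^ a i) h

/-- The Laurent monomial `x ^ e` (`e ∈ ℤ`) as a polynomial in `x` and `x⁻¹`. [folklore] -/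
def laurentMonomial (e : ℤ) : MvPolynomial (Fin 2) k :=
  if 0 ≤ e then MvPolynomial.X 0 ^ e.toNat else MvPolynomial.X 1 ^ (-e).toNat

omit [Fintype n] [DecidableEq n] in
/-- `laurentMonomial e` evaluates at `(x, x⁻¹)` to `x ^ e`. [folklore] -/
lemma eval_laurentMonomial (e : ℤ) (x : kˣ) :
    MvPolynomial.eval ![(x : k), (x⁻¹ : kˣ)] (laurentMonomial e) = ((x ^ e : kˣ) : k) := by
  unfold laurentMonomial
  split_ifs with h
  · rw [map_pow, MvPolynomial.eval_X, Matrix.cons_val_zero, ← Units.val_pow_eq_pow_val,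
      ← zpow_natCast, Int.toNat_of_nonneg h]
  · rw [map_pow, MvPolynomial.eval_X, Matrix.cons_val_one, Matrix.cons_val_fin_one,
      ← Units.val_pow_eq_pow_val, ← zpow_natCast, Int.toNat_of_nonneg (by omega), inv_zpow',
      neg_neg]

omit [Fintype n] [DecidableEq n] in
/-- `x ^ (∑ aᵢ) = ∏ x ^ aᵢ` in a commutative group. [folklore] -/
lemma zpow_finset_sum {G : Type*} [CommGroup G] (x : G) (s : Finset n) (a : n → ℤ) :
    x ^ (∑ i ∈ s, a i) = ∏ i ∈ s, x ^ a i := by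
  classical
  induction s using Finset.induction_on with
  | empty => simp
  | insert i s hi ih => rw [Finset.sum_insert hi, Finset.prod_insert hi, zpow_add, ih]

/-- For `a ∈ ℤⁿ` with `diag(x ^ a) ∈ T` for all `x`, the cocharacter `x ↦ diag(x ^ a)` of `T`.
[cite: SpringerLAG1998, 3.2.2] -/
def cocharOfVec (a : n → ℤ) (ha : ∀ x : kˣ, diagonalGL n k (fun i => x ^ a i) ∈ T) :
    kˣ →* ↥T where
  toFun x := ⟨diagonalGL n k (fun i => x ^ a i), ha x⟩
  map_one' := Subtype.ext (by
    change diagonalGL n k (fun i => (1 : kˣ) ^ a i) = 1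
    simp only [one_zpow]
    exact map_one (diagonalGL n k))
  map_mul' x y := Subtype.ext (by
    change diagonalGL n k (fun i => (x * y) ^ a i) =
      diagonalGL n k (fun i => x ^ a i) * diagonalGL n k (fun i => y ^ a i)
    rw [← map_mul]
    congr 1
    funext i
    exact mul_zpow x y (a i))

omit [IsMulCommutative ↥T] in
/-- `x ↦ diag(x ^ a)` is an algebraic cocharacter (coordinates are Laurent monomials in `x`).
[cite: SpringerLAG1998, 3.2.2] -/
lemma isAlgebraicCochar_cocharOfVec (a : n → ℤ)
    (ha : ∀ x : kˣ, diagonalGL n k (fun i => x ^ a i) ∈ T) :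
    IsAlgebraicCochar (cocharOfVec a ha) := by
  classical
  refine ⟨fun c => match c with
    | Sum.inl ij => if ij.1 = ij.2 then laurentMonomial (a ij.1) else 0
    | Sum.inr _ => laurentMonomial (-∑ i, a i), fun x c => ?_⟩
  rcases c with ⟨i, j⟩ | u
  · change glCoordFun (diagonalGL n k fun i => x ^ a i) (Sum.inl (i, j)) = _
    simp only [glCoordFun_inl, coe_diagonalGL, Matrix.diagonal_apply]
    split_ifs with h
    · subst h; rw [eval_laurentMonomial]
    · rw [map_zero]
  · change glCoordFun (diagonalGL n k fun i => x ^ a i) (Sum.inr u) = _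
    simp only [glCoordFun_inr, coe_diagonalGL, Matrix.det_diagonal]
    rw [eval_laurentMonomial, zpow_neg, zpow_finset_sum, Units.val_inv_eq_inv_val, Units.coe_prod]

/-- The exponent vector of `x ↦ diag(x ^ a)` is `a`. [cite: SpringerLAG1998, 3.2.2] -/
lemma coweightOf_cocharOfVec [Infinite k] (hT : T ≤ diagonalSubgroup n k) (a : n → ℤ)
    (ha : ∀ x : kˣ, diagonalGL n k (fun i => x ^ a i) ∈ T) :
    coweightOf hT ⟨cocharOfVec a ha, isAlgebraicCochar_cocharOfVec a ha⟩ = a := by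
  apply zpow_vec_injective (k := k)
  funext x i
  simp only
  rw [← diagCoord_apply_eq_zpow_coweightOf]
  have : diagonalGL n k (diagCoord hT (cocharOfVec a ha x)) =
      diagonalGL n k (fun i => x ^ a i) := by
    rw [diagonalGL_diagCoord]
    rfl
  exact congrFun (diagonalGL_injective this) i

/-- `a ∈ ℤⁿ` is the exponent vector of a cocharacter of `T ≤ 𝔻ₙ` iff `diag(x ^ a) ∈ T` for all `x`
(Springer 3.2.2: `X_*(𝔻ₙ) = ℤⁿ`). [cite: SpringerLAG1998, 3.2.2] -/
lemma mem_range_coweightHom_iff [Infinite k] (hT : T ≤ diagonalSubgroup n k) (a : n → ℤ) :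
    a ∈ (coweightHom hT).range ↔ ∀ x : kˣ, diagonalGL n k (fun i => x ^ a i) ∈ T := by
  constructor
  · rintro ⟨γ, rfl⟩ x
    have h := diagonalGL_diagCoord hT (((Additive.toMul γ : ↥(cocharacterLattice T)) : kˣ →* ↥T) x)
    rw [diagCoord_apply_eq] at h
    change diagonalGL n k (fun i => x ^ coweightOf hT (Additive.toMul γ) i) ∈ T
    rw [h]
    exact SetLike.coe_mem _
  · intro ha
    exact ⟨Additive.ofMul ⟨cocharOfVec a ha, isAlgebraicCochar_cocharOfVec a ha⟩,
      coweightOf_cocharOfVec hT a ha⟩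

/-- `χₘ ∘ λ = (x ↦ x ^ ⟨m, a⟩)` for the monomial character `χₘ` and a cocharacter `λ` with
exponent vector `a` (Springer 3.2.11 (i) for `𝔻ₙ`: the pairing is the standard one).
[cite: SpringerLAG1998, 3.2.11 (i)] -/
lemma diagChar_comp_eq_zpowGroupHom [Infinite k] (hT : T ≤ diagonalSubgroup n k) (m : n → ℤ)
    (γ : ↥(cocharacterLattice T)) :
    (diagChar hT m).comp (γ : kˣ →* ↥T) = zpowGroupHom (∑ i, m i * coweightOf hT γ i) := by
  ext x : 1
  rw [MonoidHom.comp_apply, diagChar_apply, diagCoord_apply_eq, zpowGroupHom_apply,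
    zpow_finset_sum]
  refine Finset.prod_congr rfl fun i _ => ?_
  rw [← zpow_mul, mul_comm]

/-- `⟨χₘ, λ⟩ = ∑ᵢ mᵢ aᵢ` (Springer 3.2.11 (i) for `𝔻ₙ`). [cite: SpringerLAG1998, 3.2.11 (i)] -/
lemma charPairingInt_diagChar [Infinite k] (hT : T ≤ diagonalSubgroup n k) (m : n → ℤ)
    (γ : ↥(cocharacterLattice T)) :
    charPairingInt (diagChar hT m) (γ : kˣ →* ↥T) = ∑ i, m i * coweightOf hT γ i := by
  obtain ⟨e, he, huniq⟩ :=
    exists_unique_charPairing_holds (diagChar_mem_characterLattice hT m) γ.2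
  rw [huniq _ (diagChar_comp_eq_zpowGroupHom hT m γ)]
  have hex : ∃ e : ℤ, (diagChar hT m).comp (γ : kˣ →* ↥T) = zpowGroupHom e := ⟨e, he⟩
  rw [charPairingInt, dif_pos hex]
  exact huniq _ hex.choose_spec

/-- **Springer 3.2.11 (i) for a closed subgroup `T` of `𝔻ₙ` with torsion-free character group**
(over an infinite field): `X*(T)` and `X_*(T)` admit dual bases for `⟨ , ⟩`.
[cite: SpringerLAG1998, 3.2.11 (i) with 3.2.2, 3.2.3, 3.2.10 (4)] -/
theorem exists_dualBases_of_le_diagonalSubgroup [Infinite k] (hTalg : IsAlgebraicSubgroup T)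
    (hT : T ≤ diagonalSubgroup n k) (htf : IsMulTorsionFree ↥(characterLattice T)) :
    ∃ (r : ℕ) (bX : Additive ↥(characterLattice T) ≃+ (Fin r → ℤ))
      (bY : Additive ↥(cocharacterLattice T) ≃+ (Fin r → ℤ)),
      ∀ (χ : ↥(characterLattice T)) (γ : ↥(cocharacterLattice T)),
        charPairingInt (χ : ↥T →* kˣ) (γ : kˣ →* ↥T) =
          ∑ i, bX (Additive.ofMul χ) i * bY (Additive.ofMul γ) i := by
  have hker : ∀ m : n → ℤ, m ∈ LinearMap.ker (weightHom hT).toIntLinearMap ↔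
      diagChar hT m = 1 := fun m => by
    rw [LinearMap.mem_ker, AddMonoidHom.coe_toIntLinearMap]
    constructor
    · intro h
      have := congrArg (fun x => ((Additive.toMul x : ↥(characterLattice T)) : ↥T →* kˣ)) h
      simpa [coe_weightHom] using this
    · intro h
      apply Additive.toMul.injective
      apply Subtype.ext
      simpa [coe_weightHom] using h
  have hrange : ∀ a : n → ℤ, a ∈ LinearMap.range (coweightHom hT).toIntLinearMap ↔
      ∀ m ∈ LinearMap.ker (weightHom hT).toIntLinearMap, ∑ i, m i * a i = 0 := by
    intro a
    have hra : a ∈ LinearMap.range (coweightHom hT).toIntLinearMap ↔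
        a ∈ (coweightHom hT).range := by
      rw [LinearMap.mem_range, AddMonoidHom.mem_range]
      rfl
    rw [hra, mem_range_coweightHom_iff]
    constructor
    · intro ha m hm
      rw [hker] at hm
      let γ : ↥(cocharacterLattice T) := ⟨cocharOfVec a ha, isAlgebraicCochar_cocharOfVec a ha⟩
      have h1 := diagChar_comp_eq_zpowGroupHom hT m γ
      rw [coweightOf_cocharOfVec, hm, MonoidHom.one_comp] at h1
      have h2 : (zpowGroupHom 0 : kˣ →* kˣ) = zpowGroupHom (∑ i, m i * a i) := by
        rw [← h1]
        ext x : 1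
        simp
      exact (zpowGroupHom_units_injective h2).symm
    · intro ha x
      refine diagonalGL_mem_of_forall_diagChar hTalg hT _ fun m hm => ?_
      have h0 := ha m ((hker m).mpr hm)
      simp only [← zpow_mul]
      rw [← zpow_finset_sum, show ∑ i, a i * m i = 0 by simpa [mul_comm] using h0, zpow_zero]
  obtain ⟨r, bX, bY, h⟩ := exists_dualBases_of_surjective_of_injective
    (weightHom hT).toIntLinearMap (weightHom_surjective hT) (coweightHom hT).toIntLinearMap
    (coweightHom_injective hT) hrange
  refine ⟨r, bX.toAddEquiv, bY.toAddEquiv, fun χ γ => ?_⟩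
  obtain ⟨m, hm⟩ := weightHom_surjective hT (Additive.ofMul χ)
  have hχ : (χ : ↥T →* kˣ) = diagChar hT m := by
    rw [← coe_weightHom hT m, hm]
    rfl
  have h' := h m (Additive.ofMul γ)
  simp only [AddMonoidHom.coe_toIntLinearMap, coweightHom_apply, hm] at h'
  rw [hχ, charPairingInt_diagChar, h']
  rfl

end DiagonalCocharacters

section Diagonalize

variable {T : Subgroup (GL n k)}

/-- **Simultaneous diagonalisation** (Springer 2.4.2 (ii) with 3.2.3 (c) ⇒ (a)): over an
algebraically closed field, a commutative subgroup of `GL n k` consisting of semisimple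
(= diagonalisable) elements is conjugate into the diagonal torus `𝔻ₙ`. Proof: the commuting
diagonalisable endomorphisms have a common eigenbasis (Mathlib: joint generalised eigenspaces of
a commuting family span and are independent; for semisimple endomorphisms they are eigenspaces);
conjugate by the change-of-basis matrix. [cite: SpringerLAG1998, 2.4.2 (ii) with 3.2.3] -/
theorem exists_conj_le_diagonalSubgroup [IsAlgClosed k] (hcomm : IsMulCommutative ↥T)
    (hss : ∀ t ∈ T, IsSemisimpleElt t) :
    ∃ g : GL n k, T.map (MulAut.conj g).toMonoidHom ≤ diagonalSubgroup n k := by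
  classical
  let f : ↥T → Module.End k (n → k) := fun t => Matrix.toLin' ((t : GL n k) : Matrix n n k)
  have hc : ∀ s t : ↥T, Commute (f s) (f t) := by
    intro s t
    have hst : (s : GL n k) * t = t * s := congrArg Subtype.val (hcomm.is_comm.comm s t)
    have hst' : ((s : GL n k) : Matrix n n k) * ((t : GL n k) : Matrix n n k) =
        ((t : GL n k) : Matrix n n k) * ((s : GL n k) : Matrix n n k) := by
      rw [← Units.val_mul, hst, Units.val_mul]
    change f s * f t = f t * f s
    simp only [f, Module.End.mul_eq_comp, ← Matrix.toLin'_mul, hst']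
  have hcommute : Pairwise fun s t => Commute (f s) (f t) := fun s t _ => hc s t
  have htri : ∀ t, ⨆ μ, (f t).maxGenEigenspace μ = ⊤ := fun t =>
    Module.End.iSup_maxGenEigenspace_eq_top (f t)
  have htop :=
    Module.End.iSup_iInf_maxGenEigenspace_eq_top_of_iSup_maxGenEigenspace_eq_top_of_commute f
      hcommute htri
  have hind := Module.End.independent_iInf_maxGenEigenspace_of_forall_mapsTo f
    (fun i j φ => Module.End.mapsTo_maxGenEigenspace_of_comm (hc j i) φ)
  let W : (↥T → k) → Submodule k (n → k) := fun χ => ⨅ t, (f t).maxGenEigenspace (χ t)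
  have hint : DirectSum.IsInternal W :=
    DirectSum.isInternal_submodule_of_iSupIndep_of_iSup_eq_top hind htop
  let B₀ := hint.collectedBasis fun χ => Module.finBasis k ↥(W χ)
  let e := Pi.basisFun k n
  let B : Module.Basis n k (n → k) := B₀.reindex (B₀.indexEquiv e)
  -- each `B i` is a common eigenvector
  have heig : ∀ (t : ↥T) (i : n), ∃ c : k, f t (B i) = c • B i := by
    intro t i
    rw [Module.Basis.reindex_apply]
    set a := (B₀.indexEquiv e).symm i
    have hmem : B₀ a ∈ W a.1 := hint.collectedBasis_mem _ a
    have hmem' : B₀ a ∈ (f t).maxGenEigenspace (a.1 t) := (Submodule.mem_iInf _).mp hmem t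
    rw [(Module.End.IsSemisimple.isFinitelySemisimple (hss _ t.2)).maxGenEigenspace_eq_eigenspace,
      Module.End.mem_eigenspace_iff] at hmem'
    exact ⟨_, hmem'⟩
  choose c hc using heig
  -- change of basis
  let P : Matrix n n k := e.toMatrix B
  let Q : Matrix n n k := B.toMatrix e
  have hPQ : P * Q = 1 := e.toMatrix_mul_toMatrix_flip B
  have hQP : Q * P = 1 := B.toMatrix_mul_toMatrix_flip e
  let g : GL n k := ⟨Q, P, hQP, hPQ⟩
  have hdiag : ∀ t : ↥T, Q * ((t : GL n k) : Matrix n n k) * P = Matrix.diagonal (c t) := by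
    intro t
    have h1 : LinearMap.toMatrix B B (f t) = Matrix.diagonal (c t) := by
      ext i j
      rw [LinearMap.toMatrix_apply, hc, map_smul, B.repr_self, Matrix.diagonal_apply,
        Finsupp.smul_apply, Finsupp.single_apply, smul_eq_mul]
      split_ifs with h1 h2 h2
      · subst h1; exact mul_one _
      · exact absurd h1.symm h2
      · exact absurd h2.symm h1
      · exact mul_zero _
    have h2 : LinearMap.toMatrix e e (f t) = ((t : GL n k) : Matrix n n k) := by
      rw [LinearMap.toMatrix_eq_toMatrix', LinearMap.toMatrix'_toLin']
    rw [← h1, ← basis_toMatrix_mul_linearMap_toMatrix (c := B) (c' := e),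
      ← linearMap_toMatrix_mul_basis_toMatrix (b := B) (b' := e), h2, Matrix.mul_assoc]
  refine ⟨g, ?_⟩
  rintro x ⟨t, ht, rfl⟩
  have hne : ∀ i, c ⟨t, ht⟩ i ≠ 0 := by
    have hunit : IsUnit (((g * t * g⁻¹ : GL n k) : Matrix n n k)) := Units.isUnit _
    rw [Matrix.isUnit_iff_isUnit_det] at hunit
    have hmat : ((g * t * g⁻¹ : GL n k) : Matrix n n k) = Matrix.diagonal (c ⟨t, ht⟩) := by
      rw [Units.val_mul, Units.val_mul]
      exact hdiag ⟨t, ht⟩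
    rw [hmat, Matrix.det_diagonal] at hunit
    exact fun i => (Finset.prod_ne_zero_iff.mp hunit.ne_zero) i (Finset.mem_univ i)
  refine ⟨fun i => Units.mk0 _ (hne i), Units.ext ?_⟩
  rw [coe_diagonalGL]
  change Matrix.diagonal (fun i => c ⟨t, ht⟩ i) = ((g * t * g⁻¹ : GL n k) : Matrix n n k)
  rw [Units.val_mul, Units.val_mul]
  exact (hdiag ⟨t, ht⟩).symm

end Diagonalize

/-! ### Transport along conjugation -/

section Conjugation

variable {T : Subgroup (GL n k)}

/-- The isomorphism `T ≃ g T g⁻¹`. [folklore] -/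
abbrev conjEquiv (g : GL n k) (T : Subgroup (GL n k)) :
    ↥T ≃* ↥(T.map (MulAut.conj g : GL n k →* GL n k)) :=
  (MulAut.conj g).subgroupMap T

/-- `conjEquiv g T t = g t g⁻¹`. [folklore] -/
lemma coe_conjEquiv_apply (g : GL n k) (t : ↥T) :
    ((conjEquiv g T t : ↥(T.map (MulAut.conj g : GL n k →* GL n k))) : GL n k) = g * t * g⁻¹ :=
  MulEquiv.coe_subgroupMap_apply _ _ _

/-- `(conjEquiv g T)⁻¹ t = g⁻¹ t g`. [folklore] -/
lemma coe_conjEquiv_symm_apply (g : GL n k) (t : ↥(T.map (MulAut.conj g : GL n k →* GL n k))) :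
    (((conjEquiv g T).symm t : ↥T) : GL n k) = g⁻¹ * t * g := by
  rw [MulEquiv.subgroupMap_symm_apply]
  exact MulAut.conj_symm_apply _ _

/-- Algebraic characters pull back along conjugation. [folklore] -/
theorem IsAlgebraicChar.comp_conjEquiv (g : GL n k)
    {χ : ↥(T.map (MulAut.conj g : GL n k →* GL n k)) →* kˣ} (hχ : IsAlgebraicChar χ) :
    IsAlgebraicChar (χ.comp (conjEquiv g T).toMonoidHom) := by
  obtain ⟨p, hp⟩ := hχ
  refine ⟨MvPolynomial.bind₁ (conjPolyGL g g⁻¹) p, fun t => ?_⟩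
  rw [MonoidHom.comp_apply, MulEquiv.coe_toMonoidHom, hp, eval_bind₁]
  simp only [eval_conjPolyGL, coe_conjEquiv_apply]

/-- Algebraic characters push forward along conjugation. [folklore] -/
theorem IsAlgebraicChar.comp_conjEquiv_symm (g : GL n k) {χ : ↥T →* kˣ} (hχ : IsAlgebraicChar χ) :
    IsAlgebraicChar (χ.comp (conjEquiv g T).symm.toMonoidHom) := by
  obtain ⟨p, hp⟩ := hχ
  refine ⟨MvPolynomial.bind₁ (conjPolyGL g⁻¹ g) p, fun t => ?_⟩
  rw [MonoidHom.comp_apply, MulEquiv.coe_toMonoidHom, hp, eval_bind₁]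
  simp only [eval_conjPolyGL, coe_conjEquiv_symm_apply]

/-- `X*(g T g⁻¹) ≃ X*(T)` by pull-back along conjugation. [folklore] -/
def characterLatticeConjEquiv (g : GL n k) (T : Subgroup (GL n k)) :
    ↥(characterLattice (T.map (MulAut.conj g : GL n k →* GL n k))) ≃* ↥(characterLattice T) where
  toFun χ := ⟨(χ : ↥(T.map (MulAut.conj g : GL n k →* GL n k)) →* kˣ).comp
    (conjEquiv g T).toMonoidHom, IsAlgebraicChar.comp_conjEquiv g χ.2⟩
  invFun χ := ⟨(χ : ↥T →* kˣ).comp (conjEquiv g T).symm.toMonoidHom,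
    IsAlgebraicChar.comp_conjEquiv_symm g χ.2⟩
  left_inv χ := Subtype.ext (MonoidHom.ext fun t => by
    simp only [MonoidHom.comp_apply, MulEquiv.coe_toMonoidHom, MulEquiv.apply_symm_apply])
  right_inv χ := Subtype.ext (MonoidHom.ext fun t => by
    simp only [MonoidHom.comp_apply, MulEquiv.coe_toMonoidHom, MulEquiv.symm_apply_apply])
  map_mul' _ _ := rfl

/-- Algebraic cocharacters push forward along conjugation. [folklore] -/
theorem IsAlgebraicCochar.conjEquiv_comp (g : GL n k) {γ : kˣ →* ↥T} (hγ : IsAlgebraicCochar γ) :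
    IsAlgebraicCochar ((conjEquiv g T).toMonoidHom.comp γ) := by
  obtain ⟨P, hP⟩ := hγ
  refine ⟨fun c => MvPolynomial.bind₁ P (conjPolyGL g g⁻¹ c), fun x c => ?_⟩
  have hx : glCoordFun ((γ x : ↥T) : GL n k) =
      fun d => MvPolynomial.eval ![(x : k), (x⁻¹ : kˣ)] (P d) := funext (hP x)
  rw [eval_bind₁, ← hx, eval_conjPolyGL, MonoidHom.comp_apply, MulEquiv.coe_toMonoidHom,
    coe_conjEquiv_apply]

/-- Algebraic cocharacters pull back along conjugation. [folklore] -/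
theorem IsAlgebraicCochar.conjEquiv_symm_comp (g : GL n k)
    {γ : kˣ →* ↥(T.map (MulAut.conj g : GL n k →* GL n k))} (hγ : IsAlgebraicCochar γ) :
    IsAlgebraicCochar ((conjEquiv g T).symm.toMonoidHom.comp γ) := by
  obtain ⟨P, hP⟩ := hγ
  refine ⟨fun c => MvPolynomial.bind₁ P (conjPolyGL g⁻¹ g c), fun x c => ?_⟩
  have hx : glCoordFun ((γ x : ↥(T.map (MulAut.conj g : GL n k →* GL n k))) : GL n k) =
      fun d => MvPolynomial.eval ![(x : k), (x⁻¹ : kˣ)] (P d) := funext (hP x)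
  rw [eval_bind₁, ← hx, eval_conjPolyGL, MonoidHom.comp_apply, MulEquiv.coe_toMonoidHom,
    coe_conjEquiv_symm_apply]

/-- `X_*(T) ≃ X_*(g T g⁻¹)` by push-forward along conjugation. [folklore] -/
def cocharacterLatticeConjEquiv (g : GL n k) (T : Subgroup (GL n k)) [IsMulCommutative ↥T] :
    ↥(cocharacterLattice T) ≃*
      ↥(cocharacterLattice (T.map (MulAut.conj g : GL n k →* GL n k))) where
  toFun γ := ⟨(conjEquiv g T).toMonoidHom.comp (γ : kˣ →* ↥T),
    IsAlgebraicCochar.conjEquiv_comp g γ.2⟩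
  invFun γ := ⟨(conjEquiv g T).symm.toMonoidHom.comp
    (γ : kˣ →* ↥(T.map (MulAut.conj g : GL n k →* GL n k))),
    IsAlgebraicCochar.conjEquiv_symm_comp g γ.2⟩
  left_inv γ := Subtype.ext (MonoidHom.ext fun x => by
    simp only [MonoidHom.comp_apply, MulEquiv.coe_toMonoidHom, MulEquiv.symm_apply_apply])
  right_inv γ := Subtype.ext (MonoidHom.ext fun x => by
    simp only [MonoidHom.comp_apply, MulEquiv.coe_toMonoidHom, MulEquiv.apply_symm_apply])
  map_mul' γ γ' := Subtype.ext (MonoidHom.ext fun x => by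
    simp only [Subgroup.coe_mul, MonoidHom.mul_apply, MonoidHom.comp_apply,
      MulEquiv.coe_toMonoidHom, map_mul])

/-- The pairing is invariant under conjugation: `⟨χ ∘ Int(g), λ⟩ = ⟨χ, Int(g) ∘ λ⟩`. [folklore] -/
theorem charPairingInt_comp_conjEquiv (g : GL n k)
    (χ : ↥(T.map (MulAut.conj g : GL n k →* GL n k)) →* kˣ) (γ : kˣ →* ↥T) :
    charPairingInt (χ.comp (conjEquiv g T).toMonoidHom) γ =
      charPairingInt χ ((conjEquiv g T).toMonoidHom.comp γ) := by
  simp only [charPairingInt, MonoidHom.comp_assoc]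

end Conjugation

/-! ### Springer 3.2.11 (i) for `IsTorusSubgroup` -/

section Torus

variable {T : Subgroup (GL n k)}

/-- **Springer 3.2.11 (i) with 3.2.7 (iii)** for the tree's `IsTorusSubgroup`: over an
algebraically closed field, the character and cocharacter groups of a torus `T ≤ GL n k` admit
dual bases for the pairing `⟨χ, λ⟩` (`charPairingInt`). Proof: conjugate `T` into `𝔻ₙ`
(`exists_conj_le_diagonalSubgroup`), apply the diagonal case
(`exists_dualBases_of_le_diagonalSubgroup`) and transport characters, cocharacters and the
pairing back along `Int(g)`. [cite: SpringerLAG1998, 3.2.11 (i) with 3.2.2, 3.2.7 (ii)–(iii)] -/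
theorem exists_dualBases_of_isTorusSubgroup [IsAlgClosed k] (hT : IsTorusSubgroup T)
    [IsMulCommutative ↥T] :
    ∃ (r : ℕ) (bX : Additive ↥(characterLattice T) ≃+ (Fin r → ℤ))
      (bY : Additive ↥(cocharacterLattice T) ≃+ (Fin r → ℤ)),
      ∀ (χ : ↥(characterLattice T)) (γ : ↥(cocharacterLattice T)),
        charPairingInt (χ : ↥T →* kˣ) (γ : kˣ →* ↥T) =
          ∑ i, bX (Additive.ofMul χ) i * bY (Additive.ofMul γ) i := by
  obtain ⟨g, hg⟩ := exists_conj_le_diagonalSubgroup hT.2.1 hT.2.2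
  have hT'alg : IsAlgebraicSubgroup (T.map (MulAut.conj g : GL n k →* GL n k)) :=
    hT.1.1.map_conj g
  haveI := isMulTorsionFree_characterLattice hT.1
  have htf' : IsMulTorsionFree ↥(characterLattice (T.map (MulAut.conj g : GL n k →* GL n k))) :=
    Function.Injective.isMulTorsionFree (characterLatticeConjEquiv g T).toMonoidHom
      (characterLatticeConjEquiv g T).injective
  obtain ⟨r, bX', bY', h'⟩ := exists_dualBases_of_le_diagonalSubgroup hT'alg hg htf'
  let eX : Additive ↥(characterLattice T) ≃+
      Additive ↥(characterLattice (T.map (MulAut.conj g : GL n k →* GL n k))) :=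
    MulEquiv.toAdditive (characterLatticeConjEquiv g T).symm
  let eY : Additive ↥(cocharacterLattice T) ≃+
      Additive ↥(cocharacterLattice (T.map (MulAut.conj g : GL n k →* GL n k))) :=
    MulEquiv.toAdditive (cocharacterLatticeConjEquiv g T)
  refine ⟨r, eX.trans bX', eY.trans bY', fun χ γ => ?_⟩
  have h'' := h' ((characterLatticeConjEquiv g T).symm χ) (cocharacterLatticeConjEquiv g T γ)
  have hc : (((χ : ↥T →* kˣ).comp (conjEquiv g T).symm.toMonoidHom).comp
      ((conjEquiv g T).toMonoidHom.comp (γ : kˣ →* ↥T))) =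
        (χ : ↥T →* kˣ).comp (γ : kˣ →* ↥T) :=
    MonoidHom.ext fun x => by
      simp only [MonoidHom.comp_apply, MulEquiv.coe_toMonoidHom, MulEquiv.symm_apply_apply]
  have hl : charPairingInt (χ : ↥T →* kˣ) (γ : kˣ →* ↥T) =
      charPairingInt (((characterLatticeConjEquiv g T).symm χ :
          ↥(characterLattice (T.map (MulAut.conj g : GL n k →* GL n k)))) :
          ↥(T.map (MulAut.conj g : GL n k →* GL n k)) →* kˣ)
        ((cocharacterLatticeConjEquiv g T γ :
          ↥(cocharacterLattice (T.map (MulAut.conj g : GL n k →* GL n k)))) :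
          kˣ →* ↥(T.map (MulAut.conj g : GL n k →* GL n k))) := by
    change charPairingInt (χ : ↥T →* kˣ) (γ : kˣ →* ↥T) =
      charPairingInt ((χ : ↥T →* kˣ).comp (conjEquiv g T).symm.toMonoidHom)
        ((conjEquiv g T).toMonoidHom.comp (γ : kˣ →* ↥T))
    unfold charPairingInt
    rw [hc]
  rw [hl, h'']
  rfl

end Torus

end Literature.NumberTheory.Automorphic
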